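import Mathlib
import Summits.Ventures.PercRepro2.TypedTwoTerminalConn

/-!
# The two-terminal lemma (blind cell PercRepro2, p2 g3, 2026-08-25; mine-1 §26(e)) — PART II: the
typed count split over a typed edge set

`typedCount_split_finset`: the typed count over `F ⊇ L` is the sum over the typed PLACEMENTS of `L`
(three configurations supported on `L`, every `e ∈ L` open in exactly `τ e` copies) of the typed
count over `F ∖ L` (with `L` pinned closed) of the kernel at the patched copies — the `Finset` form
of `typedCount_split` (one edge). Tools: `sum_config_split` (a sum over all configurations is the
double sum over the `L`-part and the part off `L`), `sum_comm_3`, `cond_patchL` (the support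
condition splits). The identity itself is `TypedTwoTerminal.lean`.
-/

namespace Summit.Ventures.PercRepro2

namespace CovForm

namespace TypedRed

namespace TwoTerm

/-! ## Sums over configurations split along `L` -/

section Split

variable {E : Type*} [Fintype E] [DecidableEq E]

/-- The configurations supported on `L`. -/
def suppL (L : Finset E) : Finset (Config E) := Finset.univ.filter fun a => ∀ e, e ∉ L → a e = false

/-- The configurations closed on `L`. -/
def closedL (L : Finset E) : Finset (Config E) := Finset.univ.filter fun x => ∀ e ∈ L, x e = false

/-- Membership in `suppL`. -/
lemma mem_suppL {L : Finset E} {a : Config E} : a ∈ suppL L ↔ ∀ e, e ∉ L → a e = false := by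
  simp [suppL]

/-- Membership in `closedL`. -/
lemma mem_closedL {L : Finset E} {x : Config E} : x ∈ closedL L ↔ ∀ e ∈ L, x e = false := by
  simp [closedL]

variable {γ : Type*} [AddCommMonoid γ]

/-- A sum over all configurations is the double sum over the `L`-part and the part off `L`. -/
lemma sum_config_split (L : Finset E) (f : Config E → γ) :
    ∑ x, f x = ∑ a ∈ suppL L, ∑ x ∈ closedL L, f (patchL L a x) := by
  rw [← Finset.sum_product']
  refine Finset.sum_nbij' (fun x => (onL L x, offL L x)) (fun p => patchL L p.1 p.2) ?_ ?_ ?_ ?_ ?_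
  · intro x _
    rw [Finset.mem_product, mem_suppL, mem_closedL]
    exact ⟨fun e he => onL_of_not_mem he, fun e he => offL_of_mem he⟩
  · intro p _; exact Finset.mem_univ _
  · intro x _; exact patchL_onL_offL L x
  · intro p hp
    rw [Finset.mem_product, mem_suppL, mem_closedL] at hp
    exact Prod.ext (onL_patchL hp.1 _) (offL_patchL _ hp.2)
  · intro x _; rw [patchL_onL_offL]

/-- Re-nesting six sums: the three `L`-parts first. -/
lemma sum_comm_3 {α β : Type*} (s : Finset α) (c : Finset β) (G : α → β → α → β → α → β → γ) :
    (∑ a ∈ s, ∑ x ∈ c, ∑ b ∈ s, ∑ y ∈ c, ∑ d ∈ s, ∑ w ∈ c, G a x b y d w) =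
      ∑ a ∈ s, ∑ b ∈ s, ∑ d ∈ s, ∑ x ∈ c, ∑ y ∈ c, ∑ w ∈ c, G a x b y d w := by
  refine Finset.sum_congr rfl fun a _ => ?_
  rw [Finset.sum_comm]
  refine Finset.sum_congr rfl fun b _ => ?_
  have h1 : ∀ x ∈ c, (∑ y ∈ c, ∑ d ∈ s, ∑ w ∈ c, G a x b y d w) =
      ∑ d ∈ s, ∑ y ∈ c, ∑ w ∈ c, G a x b y d w := fun x _ => Finset.sum_comm
  rw [Finset.sum_congr rfl h1]
  exact Finset.sum_comm

/-- A sum over the configurations closed on `L` of a function vanishing elsewhere is the sum over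
all configurations. -/
lemma sum_closedL_eq (L : Finset E) (h : Config E → γ) (hh : ∀ x, x ∉ closedL L → h x = 0) :
    ∑ x ∈ closedL L, h x = ∑ x, h x :=
  Finset.sum_subset (Finset.subset_univ _) fun x _ hx => hh x hx

end Split

/-! ## The typed count split over `L` -/

section TypedSplit

variable {E : Type*} [Fintype E] [DecidableEq E] {R : Type*} [CommRing R]

/-- A typed placement of `L`: every `e ∈ L` open in exactly `τ e` of the three copies. -/
def IsPlacement (L : Finset E) (τ : E → ℕ) (a b c : Config E) : Prop :=
  ∀ e ∈ L, openCount a b c e = τ e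

/-- Placements are decidable. -/
instance instDecidableIsPlacement (L : Finset E) (τ : E → ℕ) (a b c : Config E) :
    Decidable (IsPlacement L τ a b c) := by
  unfold IsPlacement; infer_instance

/-- The support condition of `typedCount` at the patched copies, for `L ⊆ F`, copies supported
on `L` and remainders closed on `L`: a placement of `L` and the support condition of the count
over `F ∖ L` with `L` pinned closed. -/
lemma cond_patchL {F L : Finset E} (hLF : L ⊆ F) (z : Config E) (τ : E → ℕ) (a b c : Config E)
    {x y w : Config E} (hx : x ∈ closedL L) (hy : y ∈ closedL L) (hw : w ∈ closedL L) :
    ((∀ e, e ∉ F → patchL L a x e = z e ∧ patchL L b y e = z e ∧ patchL L c w e = z e) ∧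
        ∀ e ∈ F, openCount (patchL L a x) (patchL L b y) (patchL L c w) e = τ e) ↔
      IsPlacement L τ a b c ∧
        ((∀ e, e ∉ F \ L → x e = offL L z e ∧ y e = offL L z e ∧ w e = offL L z e) ∧
          ∀ e ∈ F \ L, openCount x y w e = τ e) := by
  rw [mem_closedL] at hx hy hw
  have hoc : ∀ e, e ∉ L → openCount (patchL L a x) (patchL L b y) (patchL L c w) e =
      openCount x y w e := fun e he => by
    simp only [openCount, patchL_of_not_mem he]
  have hoc' : ∀ e, e ∈ L → openCount (patchL L a x) (patchL L b y) (patchL L c w) e =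
      openCount a b c e := fun e he => by
    simp only [openCount, patchL_of_mem he]
  constructor
  · rintro ⟨h1, h2⟩
    refine ⟨fun e he => ?_, fun e he => ?_, fun e he => ?_⟩
    · rw [← hoc' e he]; exact h2 e (hLF he)
    · rw [Finset.mem_sdiff, not_and, not_not] at he
      by_cases heL : e ∈ L
      · rw [offL_of_mem heL]; exact ⟨hx e heL, hy e heL, hw e heL⟩
      · have heF : e ∉ F := fun h => heL (he h)
        rw [offL_of_not_mem heL]
        have := h1 e heF
        rwa [patchL_of_not_mem heL, patchL_of_not_mem heL, patchL_of_not_mem heL] at this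
    · rw [Finset.mem_sdiff] at he
      rw [← hoc e he.2]; exact h2 e he.1
  · rintro ⟨hP, h1, h2⟩
    refine ⟨fun e he => ?_, fun e he => ?_⟩
    · have heL : e ∉ L := fun h => he (hLF h)
      have heFL : e ∉ F \ L := fun h => he (Finset.mem_sdiff.1 h).1
      have := h1 e heFL
      rw [offL_of_not_mem heL] at this
      rwa [patchL_of_not_mem heL, patchL_of_not_mem heL, patchL_of_not_mem heL]
    · by_cases heL : e ∈ L
      · rw [hoc' e heL]; exact hP e heL
      · rw [hoc e heL]; exact h2 e (Finset.mem_sdiff.2 ⟨he, heL⟩)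

/-- **The typed count split over a typed edge set `L ⊆ F`**: the sum over the typed placements of
`L` of the typed counts over `F ∖ L` (with `L` pinned closed) of the kernel at the patched copies. -/
theorem typedCount_split_finset (F : Finset E) (L : Finset E) (hLF : L ⊆ F) (z : Config E)
    (τ : E → ℕ) (K : Config E → Config E → Config E → R) :
    typedCount F z τ K =
      ∑ a ∈ suppL L, ∑ b ∈ suppL L, ∑ c ∈ suppL L,
        if IsPlacement L τ a b c then
          typedCount (F \ L) (offL L z) τ
            (fun x y w => K (patchL L a x) (patchL L b y) (patchL L c w))
        else 0 := by
  unfold typedCount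
  -- split the three copies
  have h1 : (∑ x, ∑ y, ∑ w, if (∀ e, e ∉ F → x e = z e ∧ y e = z e ∧ w e = z e) ∧
      ∀ e ∈ F, openCount x y w e = τ e then K x y w else 0) =
      ∑ a ∈ suppL L, ∑ x ∈ closedL L, ∑ y, ∑ w,
        if (∀ e, e ∉ F → patchL L a x e = z e ∧ y e = z e ∧ w e = z e) ∧
          ∀ e ∈ F, openCount (patchL L a x) y w e = τ e then K (patchL L a x) y w else 0 :=
    sum_config_split L _
  have h2 : ∀ a x : Config E, (∑ y, ∑ w,
      if (∀ e, e ∉ F → patchL L a x e = z e ∧ y e = z e ∧ w e = z e) ∧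
        ∀ e ∈ F, openCount (patchL L a x) y w e = τ e then K (patchL L a x) y w else 0) =
      ∑ b ∈ suppL L, ∑ y ∈ closedL L, ∑ w,
        if (∀ e, e ∉ F → patchL L a x e = z e ∧ patchL L b y e = z e ∧ w e = z e) ∧
          ∀ e ∈ F, openCount (patchL L a x) (patchL L b y) w e = τ e then
          K (patchL L a x) (patchL L b y) w else 0 :=
    fun a x => sum_config_split L _
  have h3 : ∀ a x b y : Config E, (∑ w,
      if (∀ e, e ∉ F → patchL L a x e = z e ∧ patchL L b y e = z e ∧ w e = z e) ∧
        ∀ e ∈ F, openCount (patchL L a x) (patchL L b y) w e = τ e then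
        K (patchL L a x) (patchL L b y) w else 0) =
      ∑ c ∈ suppL L, ∑ w ∈ closedL L,
        if (∀ e, e ∉ F → patchL L a x e = z e ∧ patchL L b y e = z e ∧ patchL L c w e = z e) ∧
          ∀ e ∈ F, openCount (patchL L a x) (patchL L b y) (patchL L c w) e = τ e then
          K (patchL L a x) (patchL L b y) (patchL L c w) else 0 :=
    fun a x b y => sum_config_split L _
  rw [h1]
  simp_rw [h2, h3]
  rw [sum_comm_3]
  refine Finset.sum_congr rfl fun a _ => Finset.sum_congr rfl fun b _ =>
    Finset.sum_congr rfl fun c _ => ?_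
  -- the support condition splits
  have hcond : ∀ x ∈ closedL L, ∀ y ∈ closedL L, ∀ w ∈ closedL L,
      (if (∀ e, e ∉ F → patchL L a x e = z e ∧ patchL L b y e = z e ∧ patchL L c w e = z e) ∧
          ∀ e ∈ F, openCount (patchL L a x) (patchL L b y) (patchL L c w) e = τ e then
        K (patchL L a x) (patchL L b y) (patchL L c w) else 0) =
      if IsPlacement L τ a b c then
        (if (∀ e, e ∉ F \ L → x e = offL L z e ∧ y e = offL L z e ∧ w e = offL L z e) ∧
            ∀ e ∈ F \ L, openCount x y w e = τ e then
          K (patchL L a x) (patchL L b y) (patchL L c w) else 0)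
      else 0 := by
    intro x hx y hy w hw
    rw [if_congr (cond_patchL hLF z τ a b c hx hy hw) rfl rfl]
    by_cases hP : IsPlacement L τ a b c <;> simp [hP]
  rw [Finset.sum_congr rfl fun x hx => Finset.sum_congr rfl fun y hy =>
    Finset.sum_congr rfl fun w hw => hcond x hx y hy w hw]
  by_cases hP : IsPlacement L τ a b c
  · simp only [if_pos hP]
    -- the inner sums run over all configurations: the support forces closedness on `L`
    set g : Config E → Config E → Config E → R := fun x y w =>
      if (∀ e, e ∉ F \ L → x e = offL L z e ∧ y e = offL L z e ∧ w e = offL L z e) ∧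
          ∀ e ∈ F \ L, openCount x y w e = τ e then
        K (patchL L a x) (patchL L b y) (patchL L c w) else 0 with hg
    have hclosed : ∀ x y w : Config E, (x ∉ closedL L ∨ y ∉ closedL L ∨ w ∉ closedL L) →
        g x y w = 0 := by
      intro x y w hxyw
      rw [hg]
      simp only
      rw [if_neg]
      rintro ⟨h1, _⟩
      have hz : ∀ e ∈ L, x e = false ∧ y e = false ∧ w e = false := fun e he => by
        have heFL : e ∉ F \ L := fun h => (Finset.mem_sdiff.1 h).2 he
        have := h1 e heFL
        rwa [offL_of_mem he] at this
      rcases hxyw with h | h | h <;> rw [mem_closedL] at h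
      · exact h fun e he => (hz e he).1
      · exact h fun e he => (hz e he).2.1
      · exact h fun e he => (hz e he).2.2
    show (∑ x ∈ closedL L, ∑ y ∈ closedL L, ∑ w ∈ closedL L, g x y w) = ∑ x, ∑ y, ∑ w, g x y w
    rw [sum_closedL_eq L (fun x => ∑ y ∈ closedL L, ∑ w ∈ closedL L, g x y w) (fun x hx =>
      Finset.sum_eq_zero fun y _ => Finset.sum_eq_zero fun w _ => hclosed x y w (Or.inl hx))]
    refine Finset.sum_congr rfl fun x _ => ?_
    rw [sum_closedL_eq L (fun y => ∑ w ∈ closedL L, g x y w) (fun y hy =>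
      Finset.sum_eq_zero fun w _ => hclosed x y w (Or.inr (Or.inl hy)))]
    refine Finset.sum_congr rfl fun y _ => ?_
    exact sum_closedL_eq L (g x y) fun w hw => hclosed x y w (Or.inr (Or.inr hw))
  · simp only [if_neg hP, Finset.sum_const_zero]

end TypedSplit

end TwoTerm

end TypedRed

end CovForm

end Summit.Ventures.PercRepro2
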